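/-
Copyright (c) 2026 the pub-hodgecm-mathlib formalisation cell (harness21).  Prover seat hodgecm-mathlib-LH4-p13 (g6), req620 Track A «(D-RAM) FOUR-FRAME» squad, unit U2H:
the (ρ2b′-X) child `stub_U2H_fixedPointCensus_typeTwo_unit0` (U2H :418) — the TOP-DEPTH LAW of type RamK (side-free half of the (D3) bit evaluation, LH4-p04 (g4)'s DERIVED
T5s-RamK letter `2j + d ≤ 2jλ + 1`): `κ = ρμ∕μ` dies in `T_M ∕ T♮` exactly at depth `jλ − d + 1` when the third field `K♮` is UNRAMIFIED over `F`.  2026-09-04.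
-/
import Summits.HodgeConjecture.HodgeConjecture.Theorems.F0P3cDyRamToricLevelCensusUnrTopSidePrep   -- ★ (LH4-p08 (g5)): `exists_traceOne_of_unramified` (the `ρ`-trace-one integer `a₀`)
import Literature.NumberTheory.LocalFields.QuadraticOrderThetaFixedUnits                          -- ★ p857302 (F0P3-p01 (g32)): `v_map_sub_self_le_of_v_sub_one_le` (the `Θ`-gain `d − 1` on `U^{(c)}`)
import Literature.NumberTheory.LocalFields.WildQuadraticDatumTrace                                 -- ★ `v_varpi_pow`, `even_log_v_of_fixed`
import HarnessLib

/-!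
# Crux `H413`, line LH4 «(D-RAM) FOUR-FRAME» — unit U2H, (ρ2b′-X): THE TOP-DEPTH LAW OF TYPE RamK — «some side alive at depth `s`» ⟺ `s + d ≤ jλ + 1`

Cell `hodgecm-mathlib` (D-0151), FLOOR 0, crux item H413 = `stmt-HodgeConjecture-24833`, route of record `HCCMUnconditional`; squad F0∕P3c∕LH4; registered stub served:
`F0P3cDyRamFourFrameU2H.stub_U2H_fixedPointCensus_typeTwo_unit0` ((ρ2b′-X), U2H :418) through LH4-p14's HEAD-OF-ORGANS, RK branch of the (C0) census: F0P3-p01 (g32)'s ★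
(D3) leaf `…ToricLevelCensusRamKTop` counts the diagonal top cell as `[B_{(s₀)} : 𝒪_jˣ]·BIT`, and ★ p857635 `toricCensusSum_ramK` consumes the bit as
`2j + d ≤ 2jl + 1 ∧ (j + a + 2 ≤ m + 2d ∨ ε = side)`; this file proves the FIRST CONJUNCT («some side alive ⟺ `s₀ ≤ jλ − d + 1`», `s₀ = j + a − m = 2j − jλ`) for type RamK — the
twin of LH4-p06 (g5)'s ★ p857816 (RamM) and LH4-p08 (g5)'s type-U bit law.  THEOREMS ONLY (no `def`, no instance, no notation, no `sorry`); lane `--supports stmt-HodgeConjecture-24833`.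

THE MATHEMATICS (`M∕E` unramified with integral generator `α`, `|α − ρα| = 1`; `Θ` the involution of the RAMIFIED `M∕K♮` with datum `|ϖE − ΘϖE| = |ϖE|^d`; `T♮ := {x : Θx = x, xρx = 1}`
the norm-one torus of the UNRAMIFIED `K♮∕F`; `κ ∈ T_M := {κρκ = 1}` with `|κ − Θκ| = exp(−jλ)` — for `κ = ρμ∕μ` this is ★ LH4-p08 `token_kappa`).
* §1 UNRAMIFIED HILBERT 90 WITH DEPTH: `yρy = 1`, `|y − 1| ≤ exp(−s)` ⇒ `y = ρz∕z` with `|z − 1| ≤ exp(−s)` (`z = 1 + ρ(a₀(y − 1))`, `a₀` the `ρ`-trace-one integer ★).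
* §2 UPPER BOUND: `x ∈ T♮`, `|κ − x| ≤ exp(−s)`, `s ≥ 1` ⇒ **`s + d ≤ jλ + 1`** — `y := κ∕x = ρz∕z`, `u := z∕Θz` has `|u − 1| ≤ exp(−(s + d − 1))` (★ the `Θ`-gain on `U^{(s)}`) and
  `|κ − Θκ| = |y − Θy| = |u − ρu| ≤ |u − 1|`.
* §3 EXISTENCE: with the (non-integral) `Θ`-trace-one element `b := ϖE∕(ϖE − ΘϖE)` (`|Θb| = exp(d − 1)`), `κ_a := bκ + Θ(bκ) ∈ K♮` has `|κ − κ_a| = |Θb|·|κ − Θκ| ≤ exp(−(jλ − d + 1))`,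
  `f := κ_a ρκ_a ∈ F` has `|f − 1| ≤ exp(−(jλ − d + 1))`, the UNRAMIFIED norm surjectivity with depth (`hsurjD`, Serre V §2 Prop. 3 a): `N(U^{(n)}_{K♮}) = U^{(n)}_F`, ★
  `UnramifiedQuadraticNormSurjective.exists_mul_map_eq_of_sub_one_mem` on the third field) writes `f = gρg` with `|g − 1| ≤ exp(−(jλ − d + 1))`, and `x := κ_a∕g ∈ T♮` is within
  `exp(−(jλ − d + 1))` of `κ`.
* §4 DICTIONARY: for a unit `z` with `ρz = κ·z` (the (D3) hyperbolic unit: `z₊ = μh(α₀ − ρα₀)∕ϖE^n`, `ρh = −h`, has `ρz₊∕z₊ = ρμ∕μ`), «some side alive at depth `s`» — `z = k·e·w`,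
  `k` a `Θ`-fixed unit, `e` a `ρ`-fixed unit, `|w − 1| ≤ exp(−s)`, the TOP datum of ★ p857764 (4) ∕ p857819 §5 ∕ p857848 — ⟺ `∃ x ∈ T♮, |κ − x| ≤ exp(−s)` (Hilbert 90 on `K♮`, `hH90`).
* §5 THE LAW: for such `z`, `1 ≤ s`, `d ≤ jλ`: **«some side alive at depth `s`» ⟺ `s + d ≤ jλ + 1`**.
With ★ p857848 `topBit_iff_exists_norm_decomp` (BIT ⟺ `z = xΘx·e·w`), ★ p857819 §5 (alive ⟺ `k ∈ N` at far depth) and the owed exclusivity (X-RK), the RK `hvTop` letter reads: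
`BIT(h₊) ⟺ [s₀ + d ≤ jλ + 1] ∧ [s₀ ≤ 2d − 2 ∨ (κ_{S9}, θ)_{K♮} = 1]`.
INTERFACE.  `hsurjD` and `hH90` are the two K♮-side suppliers (the S2′ third-field package `K'`, `jK`: ★ `exists_mul_map_eq_of_sub_one_mem` with `I = 𝔪^n`, and Hilbert 90
★ `exists_eq_div_map_of_mul_map_eq_one` rescaled by a power of the `F`-uniformiser); `hdatum` = clause 5 of `IsRamifiedQuadraticDatum Θ ϖE d t`; `hΘev` = clause 4.
HONEST LABEL.  Count-neutral helper; (ρ2b′-X) OPEN; `HC_CM` is proved only modulo the 7 printed citations (2 remaining named inputs: hLiu418 = `stmt-HodgeConjecture-24832`, h413 =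
`stmt-HodgeConjecture-24833`) until rung 0 closes.

## References
* [Serre1979] J.-P. Serre, *Local Fields*, GTM 67 (1979), Ch. V §2 Prop. 3, §3 Prop. 5 and Cor. 3; Ch. IV §1; Ch. X §1.
* [Flicker1998UnitaryFL] Y. Z. Flicker, *Elementary proof of the fundamental lemma for a unitary group*, Canad. J. Math. 50 (1998), Prop. 7 p. 84.
* [Kottwitz1986BaseChangeUnits] R. E. Kottwitz, *Base change for unit elements of Hecke algebras*, Compositio Math. 60 (1986), §1 pp. 240–241.
-/

set_option autoImplicit false

open WithZero

namespace Summit.HodgeConjecture.HodgeConjecture.Cruxes.H413.F0P3cDyRamTopDepthRamK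

open Literature.NumberTheory.LocalFields.QuadraticOrder (v_map_sub_self_le_of_v_sub_one_le)
open Literature.NumberTheory.LocalFields.WildQuadraticDatum (v_varpi_pow even_log_v_of_fixed)
open Summit.HodgeConjecture.HodgeConjecture.Cruxes.H413.F0P3cDyRamToricLevelCensusUnr (exists_traceOne_of_unramified)

variable {K : Type*} [Field K] [Valued K ℤᵐ⁰]

/-- `|x| = 1` from `x·σx = 1` for an isometric `σ`. [cite: Serre1979, Ch. V §3] -/
theorem v_eq_one_of_mul_map_eq_one {σ : K →+* K} (hσv : ∀ x, Valued.v (σ x) = Valued.v x) {x : K} (h : x * σ x = 1) : Valued.v x = 1 := by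
  have h1 : Valued.v x * Valued.v x = 1 := by rw [← hσv x] ; nth_rewrite 1 [hσv x]; rw [← Valuation.map_mul, h, Valuation.map_one]
  rcases lt_trichotomy (Valued.v x) 1 with h2 | h2 | h2
  · exfalso
    have hlt : Valued.v x * Valued.v x < 1 :=
      calc Valued.v x * Valued.v x ≤ Valued.v x * 1 := by gcongr
        _ < 1 := by rw [mul_one]; exact h2
    rw [h1] at hlt; exact lt_irrefl _ hlt
  · exact h2
  · exfalso
    have hlt : 1 < Valued.v x * Valued.v x :=
      calc (1 : ℤᵐ⁰) < Valued.v x := h2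
        _ = Valued.v x * 1 := (mul_one _).symm
        _ ≤ Valued.v x * Valued.v x := by gcongr
    rw [h1] at hlt; exact lt_irrefl _ hlt

/-- A unit near `1`: `|w − 1| ≤ exp(−s)` with `1 ≤ s` gives `|w| = 1`. [cite: Serre1979, Ch. IV §1] -/
theorem v_eq_one_of_v_sub_one_le {w : K} {s : ℕ} (hs : 1 ≤ s) (hw : Valued.v (w - 1) ≤ exp (-(s : ℤ))) : Valued.v w = 1 := by
  have hlt : Valued.v (w - 1) < Valued.v (1 : K) := by
    rw [Valuation.map_one]; exact lt_of_le_of_lt hw (by rw [← exp_zero, exp_lt_exp]; omega)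
  have h := Valuation.map_add_eq_of_lt_left _ hlt
  rwa [add_sub_cancel, Valuation.map_one] at h

/-! ## §1 Unramified Hilbert 90 with depth -/

/-- **UNRAMIFIED HILBERT 90 WITH DEPTH** (`M∕E` unramified: `α` integral with `|α − ρα| = 1`): if `yρy = 1` and `|y − 1| ≤ exp(−s)` then `ρz = y·z` for some `z` with `|z − 1| ≤ exp(−s)`
— `z := 1 + ρ(a₀(y − 1))` with the `ρ`-trace-one integer `a₀` (★ `exists_traceOne_of_unramified`). [cite: Serre1979, Ch. X §1; Ch. V §2 Prop. 3] -/
theorem exists_near_one_rho_eq_mul {ρ : K →+* K} (hρρ : ∀ x, ρ (ρ x) = x) (hρv : ∀ x, Valued.v (ρ x) = Valued.v x)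
    {α : K} (hα1 : Valued.v α ≤ 1) (hαρ : Valued.v (α - ρ α) = 1)
    {y : K} (hy : y * ρ y = 1) {s : ℕ} (hys : Valued.v (y - 1) ≤ exp (-(s : ℤ))) :
    ∃ z : K, Valued.v (z - 1) ≤ exp (-(s : ℤ)) ∧ ρ z = y * z := by
  obtain ⟨a₀, ha₀1, ha₀⟩ := exists_traceOne_of_unramified hρρ hρv hα1 hαρ
  refine ⟨1 + ρ a₀ * (ρ y - 1), ?_, ?_⟩
  · rw [add_sub_cancel_left, Valuation.map_mul, hρv, show ρ y - 1 = ρ (y - 1) by rw [map_sub, map_one], hρv]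
    calc Valued.v a₀ * Valued.v (y - 1) ≤ 1 * exp (-(s : ℤ)) := mul_le_mul' ha₀1 hys
      _ = exp (-(s : ℤ)) := one_mul _
  · rw [map_add, map_one, map_mul, hρρ, map_sub, hρρ, map_one]
    linear_combination (-(ρ a₀)) * hy + (y - 1) * ha₀

/-! ## §2 The upper bound -/

/-- **UPPER BOUND: a `Θ`-fixed `ρ`-norm-one `x` within `exp(−s)` of `κ` forces `s + d ≤ jλ + 1`.**  Frame: `ρ` involutive isometric, `Θ` involutive isometric, commuting; `ϖE` a
uniformiser with `|ϖE − ΘϖE| = |ϖE|^d` (ramified `M∕K♮`), `Θ`-fixed non-zero elements of even valuation; `α` integral with `|α − ρα| = 1` (unramified `M∕E`).  If `κρκ = 1`,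
`exp(−jλ) ≤ |κ − Θκ|`, `Θx = x`, `xρx = 1`, `|κ − x| ≤ exp(−s)`, `1 ≤ s`, then `s + d ≤ jλ + 1`: `κ∕x = ρz∕z` (§1), `u = z∕Θz` gains `d − 1` (★), `|κ − Θκ| = |u − ρu| ≤ |u − 1|`.
[cite: Serre1979, Ch. V §3 Prop. 5; Ch. IV §1] [cite: Flicker1998UnitaryFL, p. 84] -/
theorem add_le_of_thetaFixed_normOne_near {ρ Θ : K →+* K} (hρρ : ∀ x, ρ (ρ x) = x) (hΘΘ : ∀ x, Θ (Θ x) = x) (hρΘ : ∀ x, ρ (Θ x) = Θ (ρ x))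
    (hρv : ∀ x, Valued.v (ρ x) = Valued.v x) (hΘv : ∀ x, Valued.v (Θ x) = Valued.v x)
    {ϖE : K} (hϖE : Valued.v ϖE = exp (-1 : ℤ)) {d : ℕ} (hdatum : Valued.v (ϖE - Θ ϖE) = Valued.v ϖE ^ d)
    (hΘev : ∀ x : K, Θ x = x → x ≠ 0 → ∃ n : ℤ, Valued.v x = exp (2 * n))
    {α : K} (hα1 : Valued.v α ≤ 1) (hαρ : Valued.v (α - ρ α) = 1)
    {κ x : K} (hκ : κ * ρ κ = 1) {jl : ℕ} (hκΘ : exp (-(jl : ℤ)) ≤ Valued.v (κ - Θ κ))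
    (hΘx : Θ x = x) (hx : x * ρ x = 1) {s : ℕ} (hs : 1 ≤ s) (hκx : Valued.v (κ - x) ≤ exp (-(s : ℤ))) : s + d ≤ jl + 1 := by
  have hπ : ∀ n : ℕ, Valued.v ϖE ^ n = exp (-(n : ℤ)) := v_varpi_pow hϖE
  have hfix : ∀ a : K, Θ a = a → a ≠ 0 → Even (log (Valued.v a)) := even_log_v_of_fixed hΘev
  have hΘϖ : Θ ϖE ≠ ϖE := by
    intro h0
    rw [h0, sub_self, map_zero, hπ] at hdatum
    exact exp_ne_zero hdatum.symm
  have hvκ : Valued.v κ = 1 := v_eq_one_of_mul_map_eq_one hρv hκ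
  have hvx : Valued.v x = 1 := v_eq_one_of_mul_map_eq_one hρv hx
  have hκ0 : κ ≠ 0 := fun h0 => by rw [h0, map_zero] at hvκ; exact zero_ne_one hvκ
  have hx0 : x ≠ 0 := fun h0 => by rw [h0, map_zero] at hvx; exact zero_ne_one hvx
  -- `y := κ ∕ x`: `ρ`-norm one, within `exp(−s)` of `1`
  set y := κ / x with hy
  have hyy : y * ρ y = 1 := by rw [hy, map_div₀, div_mul_div_comm, hκ, hx, div_one]
  have hy1 : Valued.v (y - 1) ≤ exp (-(s : ℤ)) := by
    rw [hy, div_sub_one hx0, map_div₀, hvx, div_one]; exact hκx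
  obtain ⟨z, hz1, hρz⟩ := exists_near_one_rho_eq_mul hρρ hρv hα1 hαρ hyy hy1
  have hvz : Valued.v z = 1 := v_eq_one_of_v_sub_one_le hs hz1
  have hz0 : z ≠ 0 := fun h0 => by rw [h0, map_zero] at hvz; exact zero_ne_one hvz
  have hΘz0 : Θ z ≠ 0 := (map_ne_zero Θ).2 hz0
  -- the `Θ`-gain: `u := z ∕ Θz` has `|u − 1| ≤ exp(−(s + d − 1))`
  have hzΘ : Valued.v (Θ z - z) ≤ exp (-((s : ℤ) - 1)) * Valued.v (ϖE - Θ ϖE) := v_map_sub_self_le_of_v_sub_one_le hΘΘ hfix hϖE hΘϖ hz1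
  set u := z / Θ z with hu
  have hvu : Valued.v u = 1 := by rw [hu, map_div₀, hΘv, hvz, div_one]
  have hu0 : u ≠ 0 := fun h0 => by rw [h0, map_zero] at hvu; exact zero_ne_one hvu
  have hρu0 : ρ u ≠ 0 := (map_ne_zero ρ).2 hu0
  have hu1 : Valued.v (u - 1) ≤ exp (-((s : ℤ) + d - 1)) := by
    rw [hu, div_sub_one hΘz0, map_div₀, hΘv, hvz, div_one, ← neg_sub, Valuation.map_neg]
    refine hzΘ.trans ?_
    rw [hdatum, hπ, ← exp_add, exp_le_exp]; omega
  -- `κ − Θκ = −x·(u − ρu)·ρΘz ∕ z`, so `|κ − Θκ| = |u − ρu|`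
  have hyval : y = ρ z / z := by rw [eq_div_iff hz0]; exact hρz.symm
  have hκ' : κ = x * y := by rw [hy]; field_simp
  have hΘκ' : Θ κ = x * (ρ (Θ z) / Θ z) := by rw [hκ', hyval, map_mul, hΘx, map_div₀, ← hρΘ]
  have hρΘz0 : ρ (Θ z) ≠ 0 := (map_ne_zero ρ).2 hΘz0
  have hρz0 : ρ z ≠ 0 := (map_ne_zero ρ).2 hz0
  have hid : κ - Θ κ = -(x * (u - ρ u) * (ρ (Θ z) / z)) := by
    rw [hΘκ', hκ', hyval, hu, map_div₀]
    field_simp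
    ring
  have hq1 : Valued.v (ρ (Θ z) / z) = 1 := by rw [map_div₀, hρv, hΘv, hvz, div_one]
  have hκΘ' : Valued.v (κ - Θ κ) = Valued.v (u - ρ u) := by
    rw [hid, Valuation.map_neg, Valuation.map_mul, Valuation.map_mul, hvx, one_mul, hq1, mul_one]
  have hule : Valued.v (u - ρ u) ≤ exp (-((s : ℤ) + d - 1)) := by
    have h1 : u - ρ u = (u - 1) - ρ (u - 1) := by rw [map_sub, map_one]; ring
    rw [h1]
    exact (Valuation.map_sub _ _ _).trans (max_le hu1 (by rw [hρv]; exact hu1))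
  have h := hκΘ.trans (hκΘ'.le.trans hule)
  rw [exp_le_exp] at h
  omega

/-! ## §3 Existence -/

/-- **EXISTENCE: a `Θ`-fixed `ρ`-norm-one `x` within `exp(−(jλ − d + 1))` of `κ`.**  Frame as §2 (`ρ`-fixed `ϖE`); the UNRAMIFIED norm surjectivity of `K♮∕F` with depth
(`hsurjD`: every doubly-fixed `f` with `|f − 1| ≤ exp(−n)`, `n ≥ 1`, is `gρg` with `g` `Θ`-fixed, `|g − 1| ≤ exp(−n)` — Serre V §2 Prop. 3 a on the third field).  If `κρκ = 1`,
`|κ − Θκ| ≤ exp(−jλ)` and `d ≤ jλ` then `∃ x, Θx = x ∧ xρx = 1 ∧ |κ − x| ≤ exp(−(jλ − d + 1))`: `κ_a := bκ + Θ(bκ)` with `b = ϖE∕(ϖE − ΘϖE)`, `f := κ_aρκ_a = gρg`, `x := κ_a∕g`.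
[cite: Serre1979, Ch. V §2 Prop. 3, §3 Prop. 5] [cite: Kottwitz1986BaseChangeUnits, §1 pp. 240–241] -/
theorem exists_thetaFixed_normOne_near_ramK {ρ Θ : K →+* K} (hρρ : ∀ x, ρ (ρ x) = x) (hΘΘ : ∀ x, Θ (Θ x) = x) (hρΘ : ∀ x, ρ (Θ x) = Θ (ρ x))
    (hρv : ∀ x, Valued.v (ρ x) = Valued.v x) (hΘv : ∀ x, Valued.v (Θ x) = Valued.v x)
    {ϖE : K} (hϖE : Valued.v ϖE = exp (-1 : ℤ)) {d : ℕ} (hdatum : Valued.v (ϖE - Θ ϖE) = Valued.v ϖE ^ d)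
    (hsurjD : ∀ (n : ℕ) (f : K), 1 ≤ n → ρ f = f → Θ f = f → Valued.v (f - 1) ≤ exp (-(n : ℤ)) →
      ∃ g : K, Θ g = g ∧ g * ρ g = f ∧ Valued.v (g - 1) ≤ exp (-(n : ℤ)))
    {κ : K} (hκ : κ * ρ κ = 1) {jl : ℕ} (hκΘ : Valued.v (κ - Θ κ) ≤ exp (-(jl : ℤ))) (hjl : d ≤ jl) :
    ∃ x : K, Θ x = x ∧ x * ρ x = 1 ∧ Valued.v (κ - x) ≤ exp (-((jl : ℤ) - d + 1)) := by
  have hπ : ∀ n : ℕ, Valued.v ϖE ^ n = exp (-(n : ℤ)) := v_varpi_pow hϖE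
  have hvκ : Valued.v κ = 1 := v_eq_one_of_mul_map_eq_one hρv hκ
  have hκ0 : κ ≠ 0 := fun h0 => by rw [h0, map_zero] at hvκ; exact zero_ne_one hvκ
  have hskew : Valued.v (ϖE - Θ ϖE) = exp (-(d : ℤ)) := by rw [hdatum, hπ]
  have hδ0 : ϖE - Θ ϖE ≠ 0 := fun h0 => by rw [h0, map_zero] at hskew; exact (exp_ne_zero hskew.symm).elim
  -- the `Θ`-trace-one element `b := ϖE ∕ (ϖE − ΘϖE)`, `Θb = 1 − b`, `|Θb| = exp(d − 1)`
  set b := ϖE / (ϖE - Θ ϖE) with hb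
  have hδ0' : Θ ϖE - ϖE ≠ 0 := fun h0 => hδ0 (by linear_combination -h0)
  have hΘb : Θ b = 1 - b := by
    rw [hb, map_div₀, map_sub, hΘΘ]
    field_simp
    ring
  have hvΘb : Valued.v (Θ b) = exp ((d : ℤ) - 1) := by
    rw [hΘv, hb, map_div₀, hϖE, hskew, ← exp_sub]; congr 1; ring
  -- `κ_a := bκ + Θ(bκ)`
  set κa := b * κ + Θ (b * κ) with hκa
  have hΘκa : Θ κa = κa := by rw [hκa, map_add, hΘΘ, add_comm]
  have hκκa : κ - κa = Θ b * (κ - Θ κ) := by rw [hκa, map_mul, hΘb]; ring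
  have hvκκa : Valued.v (κ - κa) ≤ exp (-((jl : ℤ) - d + 1)) := by
    rw [hκκa, Valuation.map_mul, hvΘb]
    calc exp ((d : ℤ) - 1) * Valued.v (κ - Θ κ) ≤ exp ((d : ℤ) - 1) * exp (-(jl : ℤ)) := mul_le_mul' le_rfl hκΘ
      _ = exp (-((jl : ℤ) - d + 1)) := by rw [← exp_add]; congr 1; ring
  have hD1 : 1 ≤ jl - d + 1 := by omega
  have hvκa : Valued.v κa = 1 := by
    have h1 : κa = κ - (κ - κa) := by ring
    have hlt : Valued.v (κ - κa) < Valued.v κ := by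
      rw [hvκ]; exact lt_of_le_of_lt hvκκa (by rw [← exp_zero, exp_lt_exp]; omega)
    rw [h1, Valuation.map_sub_eq_of_lt_left _ hlt, hvκ]
  have hκa0 : κa ≠ 0 := fun h0 => by rw [h0, map_zero] at hvκa; exact zero_ne_one hvκa
  -- `f := κ_a ρκ_a` is doubly fixed, within `exp(−(jl − d + 1))` of `1`
  set f := κa * ρ κa with hf
  have hρf : ρ f = f := by rw [hf, map_mul, hρρ, mul_comm]
  have hΘf : Θ f = f := by rw [hf, map_mul, hΘκa, ← hρΘ, hΘκa]
  have hf1 : Valued.v (f - 1) ≤ exp (-((jl : ℤ) - d + 1)) := by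
    have h1 : f - 1 = (κa - κ) * ρ κa + κ * ρ (κa - κ) := by rw [hf, map_sub]; linear_combination hκ
    rw [h1]
    refine (Valuation.map_add _ _ _).trans (max_le ?_ ?_)
    · rw [Valuation.map_mul, hρv, hvκa, mul_one, ← neg_sub, Valuation.map_neg]; exact hvκκa
    · rw [Valuation.map_mul, hvκ, one_mul, hρv, ← neg_sub, Valuation.map_neg]; exact hvκκa
  have hcast : ((jl - d + 1 : ℕ) : ℤ) = (jl : ℤ) - d + 1 := by push_cast [Nat.cast_sub hjl]; ring
  have hf1' : Valued.v (f - 1) ≤ exp (-((jl - d + 1 : ℕ) : ℤ)) := by rw [hcast]; exact hf1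
  obtain ⟨g, hΘg, hgg, hg1⟩ := hsurjD (jl - d + 1) f hD1 hρf hΘf hf1'
  have hvg : Valued.v g = 1 := v_eq_one_of_v_sub_one_le hD1 hg1
  rw [hcast] at hg1
  have hg0 : g ≠ 0 := fun h0 => by rw [h0, map_zero] at hvg; exact zero_ne_one hvg
  have hf0 : f ≠ 0 := by rw [hf]; exact mul_ne_zero hκa0 ((map_ne_zero ρ).2 hκa0)
  -- `x := κ_a ∕ g`
  refine ⟨κa / g, by rw [map_div₀, hΘκa, hΘg], ?_, ?_⟩
  · rw [map_div₀, div_mul_div_comm, hgg, ← hf, div_self hf0]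
  · have h1 : κ - κa / g = (κ - κa) + κa * (g - 1) / g := by field_simp; ring
    rw [h1]
    refine (Valuation.map_add _ _ _).trans (max_le hvκκa ?_)
    rw [map_div₀, Valuation.map_mul, hvκa, hvg, one_mul, div_one]; exact hg1

/-! ## §4 «Some side alive at depth s» ⟺ `κ` is within `exp(−s)` of `T♮` -/

/-- **THE TOP DATUM ⟺ NEARNESS TO `T♮`.**  Frame: `ρ` involutive isometric, commuting with `Θ`; `α` integral with `|α − ρα| = 1`; Hilbert 90 on the unramified `K♮∕F` with a unit
(`hH90`: every `Θ`-fixed `ρ`-norm-one `x` is `ρk∕k`, `k` a `Θ`-fixed unit).  For a unit `z` with `ρz = κ·z` and `1 ≤ s`: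
`(∃ k e w, Θk = k ∧ |k| = 1 ∧ ρe = e ∧ |e| = 1 ∧ |w − 1| ≤ exp(−s) ∧ z = k·e·w) ↔ ∃ x, Θx = x ∧ xρx = 1 ∧ |κ − x| ≤ exp(−s)` (`→`: `x = ρk∕k`; `←`: §1 on `κ∕x`).
[cite: Serre1979, Ch. X §1; Ch. V §2] [cite: Flicker1998UnitaryFL, p. 84] -/
theorem exists_topDecomp_iff_exists_near {ρ Θ : K →+* K} (hρρ : ∀ x, ρ (ρ x) = x) (hρΘ : ∀ x, ρ (Θ x) = Θ (ρ x))
    (hρv : ∀ x, Valued.v (ρ x) = Valued.v x)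
    {α : K} (hα1 : Valued.v α ≤ 1) (hαρ : Valued.v (α - ρ α) = 1)
    (hH90 : ∀ x : K, Θ x = x → x * ρ x = 1 → ∃ k : K, Θ k = k ∧ Valued.v k = 1 ∧ ρ k = x * k)
    {z κ : K} (hz1 : Valued.v z = 1) (hκz : ρ z = κ * z) {s : ℕ} (hs : 1 ≤ s) :
    (∃ k e w : K, Θ k = k ∧ Valued.v k = 1 ∧ ρ e = e ∧ Valued.v e = 1 ∧ Valued.v (w - 1) ≤ exp (-(s : ℤ)) ∧ z = k * e * w) ↔
      ∃ x : K, Θ x = x ∧ x * ρ x = 1 ∧ Valued.v (κ - x) ≤ exp (-(s : ℤ)) := by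
  have hz0 : z ≠ 0 := fun h0 => by rw [h0, map_zero] at hz1; exact zero_ne_one hz1
  have hκeq : κ = ρ z / z := by rw [eq_div_iff hz0]; exact hκz.symm
  constructor
  · rintro ⟨k, e, w, hΘk, hvk, hρe, hve, hw, hz⟩
    have hk0 : k ≠ 0 := fun h0 => by rw [h0, map_zero] at hvk; exact zero_ne_one hvk
    have he0 : e ≠ 0 := fun h0 => by rw [h0, map_zero] at hve; exact zero_ne_one hve
    have hvw : Valued.v w = 1 := v_eq_one_of_v_sub_one_le hs hw
    have hw0 : w ≠ 0 := fun h0 => by rw [h0, map_zero] at hvw; exact zero_ne_one hvw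
    have hρk0 : ρ k ≠ 0 := (map_ne_zero ρ).2 hk0
    refine ⟨ρ k / k, by rw [map_div₀, ← hρΘ, hΘk], by rw [map_div₀, hρρ]; field_simp, ?_⟩
    have h1 : κ - ρ k / k = ρ k / k * ((ρ w - w) / w) := by
      rw [hκeq, hz, map_mul, map_mul, hρe]; field_simp
    rw [h1, Valuation.map_mul, map_div₀, hρv, div_self ((Valuation.ne_zero_iff _).2 hk0), one_mul, map_div₀, hvw, div_one,
      show ρ w - w = -((w - 1) - ρ (w - 1)) by rw [map_sub, map_one]; ring, Valuation.map_neg]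
    exact (Valuation.map_sub _ _ _).trans (max_le hw (by rw [hρv]; exact hw))
  · rintro ⟨x, hΘx, hx, hκx⟩
    have hvx : Valued.v x = 1 := v_eq_one_of_mul_map_eq_one hρv hx
    have hx0 : x ≠ 0 := fun h0 => by rw [h0, map_zero] at hvx; exact zero_ne_one hvx
    obtain ⟨k, hΘk, hvk, hρk⟩ := hH90 x hΘx hx
    have hk0 : k ≠ 0 := fun h0 => by rw [h0, map_zero] at hvk; exact zero_ne_one hvk
    have hρz0 : ρ z ≠ 0 := (map_ne_zero ρ).2 hz0
    have hκρκ : κ * ρ κ = 1 := by rw [hκeq, map_div₀, hρρ]; field_simp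
    have hκ0 : κ ≠ 0 := fun h0 => by rw [h0, zero_mul] at hκρκ; exact zero_ne_one hκρκ
    -- `y := κ ∕ x`
    have hyy : κ / x * ρ (κ / x) = 1 := by rw [map_div₀, div_mul_div_comm, hκρκ, hx, div_one]
    have hy1 : Valued.v (κ / x - 1) ≤ exp (-(s : ℤ)) := by rw [div_sub_one hx0, map_div₀, hvx, div_one]; exact hκx
    obtain ⟨w, hw1, hρw⟩ := exists_near_one_rho_eq_mul hρρ hρv hα1 hαρ hyy hy1
    have hvw : Valued.v w = 1 := v_eq_one_of_v_sub_one_le hs hw1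
    have hw0 : w ≠ 0 := fun h0 => by rw [h0, map_zero] at hvw; exact zero_ne_one hvw
    -- `e := z ∕ (k·w)` is `ρ`-fixed
    refine ⟨k, z / (k * w), w, hΘk, hvk, ?_, ?_, hw1, by field_simp⟩
    · rw [map_div₀, map_mul, hρk, hρw, hκz]
      field_simp
      try ring
    · rw [map_div₀, Valuation.map_mul, hz1, hvk, hvw, one_mul, div_one]

/-! ## §5 The law -/

/-- **THE TOP-DEPTH LAW OF TYPE RamK.**  Frame: `ρ, Θ` commuting involutive isometries; `ϖE` a uniformiser with `|ϖE − ΘϖE| = |ϖE|^d`; `Θ`-fixed non-zero elements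
of even valuation; `α` integral with `|α − ρα| = 1`; the two K♮-side suppliers `hsurjD` (unramified norm surjectivity with depth) and `hH90` (Hilbert 90 with a unit).  For a unit `z` with
`ρz = κ·z` (the (D3) hyperbolic unit, `κ = ρμ∕μ`), `|κ − Θκ| = exp(−jλ)`, `1 ≤ s`, `d ≤ jλ`:
**`(∃ k e w, Θk = k ∧ |k| = 1 ∧ ρe = e ∧ |e| = 1 ∧ |w − 1| ≤ exp(−s) ∧ z = k·e·w) ↔ s + d ≤ jλ + 1`** — «some side alive at depth `s`» iff `s ≤ jλ − d + 1`, the first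
conjunct of ★ `toricCensusSum_ramK`'s `hvTop` (`2j + d ≤ 2jλ + 1` at `s = 2j − jλ`). [cite: Serre1979, Ch. V §2 Prop. 3, §3 Prop. 5] [cite: Flicker1998UnitaryFL, p. 84]
[cite: Kottwitz1986BaseChangeUnits, §1 pp. 240–241] -/
theorem exists_topDecomp_iff_add_le {ρ Θ : K →+* K} (hρρ : ∀ x, ρ (ρ x) = x) (hΘΘ : ∀ x, Θ (Θ x) = x) (hρΘ : ∀ x, ρ (Θ x) = Θ (ρ x))
    (hρv : ∀ x, Valued.v (ρ x) = Valued.v x) (hΘv : ∀ x, Valued.v (Θ x) = Valued.v x)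
    {ϖE : K} (hϖE : Valued.v ϖE = exp (-1 : ℤ)) {d : ℕ} (hdatum : Valued.v (ϖE - Θ ϖE) = Valued.v ϖE ^ d)
    (hΘev : ∀ x : K, Θ x = x → x ≠ 0 → ∃ n : ℤ, Valued.v x = exp (2 * n))
    {α : K} (hα1 : Valued.v α ≤ 1) (hαρ : Valued.v (α - ρ α) = 1)
    (hsurjD : ∀ (n : ℕ) (f : K), 1 ≤ n → ρ f = f → Θ f = f → Valued.v (f - 1) ≤ exp (-(n : ℤ)) →
      ∃ g : K, Θ g = g ∧ g * ρ g = f ∧ Valued.v (g - 1) ≤ exp (-(n : ℤ)))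
    (hH90 : ∀ x : K, Θ x = x → x * ρ x = 1 → ∃ k : K, Θ k = k ∧ Valued.v k = 1 ∧ ρ k = x * k)
    {z κ : K} (hz1 : Valued.v z = 1) (hκz : ρ z = κ * z) {jl : ℕ} (hκΘ : Valued.v (κ - Θ κ) = exp (-(jl : ℤ)))
    {s : ℕ} (hs : 1 ≤ s) (hjl : d ≤ jl) :
    (∃ k e w : K, Θ k = k ∧ Valued.v k = 1 ∧ ρ e = e ∧ Valued.v e = 1 ∧ Valued.v (w - 1) ≤ exp (-(s : ℤ)) ∧ z = k * e * w) ↔ s + d ≤ jl + 1 := by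
  have hz0 : z ≠ 0 := fun h0 => by rw [h0, map_zero] at hz1; exact zero_ne_one hz1
  have hρz0 : ρ z ≠ 0 := (map_ne_zero ρ).2 hz0
  have hκρκ : κ * ρ κ = 1 := by
    have hκeq : κ = ρ z / z := by rw [eq_div_iff hz0]; exact hκz.symm
    rw [hκeq, map_div₀, hρρ]; field_simp
  rw [exists_topDecomp_iff_exists_near hρρ hρΘ hρv hα1 hαρ hH90 hz1 hκz hs]
  constructor
  · rintro ⟨x, hΘx, hx, hκx⟩
    exact add_le_of_thetaFixed_normOne_near hρρ hΘΘ hρΘ hρv hΘv hϖE hdatum hΘev hα1 hαρ hκρκ hκΘ.symm.le hΘx hx hs hκx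
  · intro hsd
    obtain ⟨x, hΘx, hx, hκx⟩ := exists_thetaFixed_normOne_near_ramK hρρ hΘΘ hρΘ hρv hΘv hϖE hdatum hsurjD hκρκ hκΘ.le hjl
    exact ⟨x, hΘx, hx, hκx.trans (by rw [exp_le_exp]; omega)⟩

end Summit.HodgeConjecture.HodgeConjecture.Cruxes.H413.F0P3cDyRamTopDepthRamK
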